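import Mathlib
import Summits.Ventures.PercRepro2.SwOutCrossJunctionToggle
import Summits.Ventures.PercRepro2.SwOutCoreShadowUnion

/-!
# The flip of an arm-closed set of a block point is a block point, II: the orbit closure (blind
cell PercRepro2, night-4 g24, 2026-08-28; proofs/NIGHT4-G24.md §6)

A core-free non-leaking point of the cube of a cross base is a SLAB point — all u-arms red or all
blue (`slab_of_coreFree`: a u-arm on each side puts `u` into both clusters of `h`).  The toggled
point of a slab point along an arm-closed set does not leak (`not_leak_toggleX`): with `u ∉ W`
only far arms toggle; with `u ∈ W` the T-slab goes to the B-slab, the dropped vertices inside `W`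
being exactly the attached ones, so the toggled fibre is `attToggle` and its blue-attached set
is the red-attached set of the source, whose outside bits are blue (`attE_attToggle_flip`); the
B-slab by the mirror.  Hence **every point of the coarse orbit of a core-free point of the block
is a point of the block** (`exists_crossReal_of_mem_orbit`).
-/

namespace Summit.Ventures.PercRepro2

namespace CrossArm

open Hull LocRows

variable {V : Type*} {E : Type*}

open scoped Classical

section Orbit

variable {ends : E → Sym2 V} {σ : Config E} {h u : V} {ι X κ : Type*} {U : ι → Set V}
  {p : X → V} {G : SimpleGraph X} {F : κ → Set V} (hb : CrossBase ends σ h u U p G F)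
  (hup : ∀ i, ∃ e, ends e = s(u, p i)) (hcross : ∀ i j, G.Adj i j → ∃ e, ends e = s(p i, p j))
  {q : PtXG ι κ X G} (hqR : ¬ LeakRX G q) (hqB : ¬ LeakBX G q)
include hb hup hcross hqR hqB

/-- **A core-free non-leaking point is a slab point.** -/
theorem CrossBase.slab_of_coreFree (hc : CoreFree ends (crossReal ends u U p G F σ q) h) :
    (∀ j, q.2.1 j = true) ∨ ∀ j, q.2.1 j = false := by
  by_contra hcon
  have h1 : ∃ j, q.2.1 j = false := by
    by_contra h'
    exact hcon (Or.inl fun j => by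
      cases hj : q.2.1 j with
      | true => rfl
      | false => exact absurd ⟨j, hj⟩ h')
  have h2 : ∃ j, q.2.1 j = true := by
    by_contra h'
    exact hcon (Or.inr fun j => by
      cases hj : q.2.1 j with
      | true => exact absurd ⟨j, hj⟩ h'
      | false => rfl)
  obtain ⟨j₁, hj₁⟩ := h1
  obtain ⟨j₂, hj₂⟩ := h2
  have huR : u ∈ cluster ends (crossReal ends u U p G F σ q) h := by
    rw [hb.cluster_crossReal hup hcross hqR, mem_redSetX_iff]
    exact Or.inr (Or.inr (Or.inl ⟨rfl, j₂, hj₂⟩))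
  have huB : u ∈ cluster ends (blue (crossReal ends u U p G F σ q)) h := by
    rw [hb.cluster_blue_crossReal hup hcross hqB, mem_redSetX_iff]
    exact Or.inr (Or.inr (Or.inl ⟨rfl, j₁, by simp [flipXG, flipAll, hj₁]⟩))
  exact hb.hne_hu (hc u huR huB).symm

/-- On the T-slab a dropped vertex is in the hull of `h` iff it is attached. -/
lemma CrossBase.p_mem_hull_iff_T [Nonempty ι] (hT : ∀ j, q.2.1 j = true) (i : X) :
    p i ∈ hull ends (crossReal ends u U p G F σ q) h ↔ attE G q.2.2 i := by
  rw [hull, Set.mem_union, hb.cluster_crossReal hup hcross hqR,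
    hb.cluster_blue_crossReal hup hcross hqB, mem_redSetX_iff, mem_redSetX_iff]
  constructor
  · rintro ((h' | ⟨j, -, h'⟩ | ⟨h', -⟩ | ⟨i', hi', -, hatt⟩ | ⟨k, -, h'⟩) |
      (h' | ⟨j, -, h'⟩ | ⟨h', -⟩ | ⟨i', -, ⟨j, hj⟩, -⟩ | ⟨k, -, h'⟩))
    · exact absurd h' (hb.hne_hp i).symm
    · exact absurd h' (hb.p_notMem_U i j)
    · exact absurd h' (hb.hne_up i).symm
    · rw [hb.p_inj hi']; exact hatt
    · exact absurd h' (hb.p_notMem_F i k)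
    · exact absurd h' (hb.hne_hp i).symm
    · exact absurd h' (hb.p_notMem_U i j)
    · exact absurd h' (hb.hne_up i).symm
    · simp [flipXG, flipAll, hT j] at hj
    · exact absurd h' (hb.p_notMem_F i k)
  · intro hatt
    exact Or.inl (Or.inr (Or.inr (Or.inr (Or.inl ⟨i, rfl, ⟨Classical.arbitrary ι, hT _⟩, hatt⟩))))

/-- On the B-slab a dropped vertex is in the hull of `h` iff it is blue-attached. -/
lemma CrossBase.p_mem_hull_iff_B [Nonempty ι] (hB : ∀ j, q.2.1 j = false) (i : X) :
    p i ∈ hull ends (crossReal ends u U p G F σ q) h ↔ attE G q.2.2.flip i := by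
  rw [hull, Set.mem_union, hb.cluster_crossReal hup hcross hqR,
    hb.cluster_blue_crossReal hup hcross hqB, mem_redSetX_iff, mem_redSetX_iff]
  constructor
  · rintro ((h' | ⟨j, -, h'⟩ | ⟨h', -⟩ | ⟨i', -, ⟨j, hj⟩, -⟩ | ⟨k, -, h'⟩) |
      (h' | ⟨j, -, h'⟩ | ⟨h', -⟩ | ⟨i', hi', -, hatt⟩ | ⟨k, -, h'⟩))
    · exact absurd h' (hb.hne_hp i).symm
    · exact absurd h' (hb.p_notMem_U i j)
    · exact absurd h' (hb.hne_up i).symm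
    · rw [hB j] at hj; exact Bool.noConfusion hj
    · exact absurd h' (hb.p_notMem_F i k)
    · exact absurd h' (hb.hne_hp i).symm
    · exact absurd h' (hb.p_notMem_U i j)
    · exact absurd h' (hb.hne_up i).symm
    · rw [hb.p_inj hi']; exact hatt
    · exact absurd h' (hb.p_notMem_F i k)
  · intro hatt
    exact Or.inr (Or.inr (Or.inr (Or.inr (Or.inl ⟨i, rfl,
      ⟨Classical.arbitrary ι, by simp [flipXG, flipAll, hB]⟩, hatt⟩))))

variable {W : Set V} (hW : ArmClosed ends (crossReal ends u U p G F σ q) h W)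
include hW

omit hcross hqR hqB in
/-- With `u ∈ W`, a dropped vertex is in `W` iff it is in the hull of `h`. -/
lemma CrossBase.p_mem_W_iff (huW : u ∈ W) (i : X) :
    p i ∈ W ↔ p i ∈ hull ends (crossReal ends u U p G F σ q) h := by
  constructor
  · intro hp; exact (hW.subset (p i) hp).1
  · intro hp
    obtain ⟨e, he⟩ := hup i
    exact hW.closed e u (p i) he huW hp (hb.hne_hp i).symm

/-- With `u ∉ W` the toggled point keeps its u-arm bits and its fibre. -/
lemma CrossBase.toggleX_snd_of_notMem (huW : u ∉ W) : (toggleX u p F q W).2 = q.2 := by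
  have hp : ∀ i, p i ∉ W := fun i hp => huW (hb.u_mem_of_p_mem_X hup hcross hqR hqB hW hp)
  simp only [toggleX, if_neg huW]
  refine Prod.ext rfl (Prod.ext rfl (Prod.ext ?_ ?_))
  · funext s
    show (if ∃ i ∈ s.1, p i ∈ W then !q.2.2.2.1 s else q.2.2.2.1 s) = q.2.2.2.1 s
    rw [if_neg]
    rintro ⟨i, -, hi⟩
    exact hp i hi
  · funext i
    show (if p i ∈ W then !q.2.2.2.2 i else q.2.2.2.2 i) = q.2.2.2.2 i
    rw [if_neg (hp i)]

/-- On the T-slab with `u ∈ W` the toggled fibre is the attachment toggle. -/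
lemma CrossBase.toggleX_fib_T [Nonempty ι] (hT : ∀ j, q.2.1 j = true) (huW : u ∈ W) :
    (toggleX u p F q W).2.2 = attToggle G q.2.2 := by
  have key : ∀ i, p i ∈ W ↔ attE G q.2.2 i := fun i => by
    rw [hb.p_mem_W_iff hup hW huW, hb.p_mem_hull_iff_T hup hcross hqR hqB hT]
  simp only [toggleX, attToggle, if_pos huW]
  refine Prod.ext rfl (Prod.ext ?_ ?_)
  · funext s
    simp only [key]
  · funext i
    simp only [key]

/-- On the B-slab with `u ∈ W` the toggled fibre is the flip of the attachment toggle of the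
flipped fibre. -/
lemma CrossBase.toggleX_fib_B [Nonempty ι] (hB : ∀ j, q.2.1 j = false) (huW : u ∈ W) :
    (toggleX u p F q W).2.2 = (attToggle G q.2.2.flip).flip := by
  have key : ∀ i, p i ∈ W ↔ attE G q.2.2.flip i := fun i => by
    rw [hb.p_mem_W_iff hup hW huW, hb.p_mem_hull_iff_B hup hcross hqR hqB hB]
  rw [attToggle_flip_flip]
  simp only [toggleX, if_pos huW]
  refine Prod.ext rfl (Prod.ext ?_ ?_)
  · funext s
    simp only [key]
  · funext i
    simp only [key]

/-- **The toggled point of a slab point along an arm-closed set does not leak.** -/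
theorem CrossBase.not_leak_toggleX [Nonempty ι]
    (hslab : (∀ j, q.2.1 j = true) ∨ ∀ j, q.2.1 j = false) :
    ¬ LeakRX G (toggleX u p F q W) ∧ ¬ LeakBX G (toggleX u p F q W) := by
  by_cases huW : u ∈ W
  · rcases hslab with hT | hB
    · -- T-slab → B-slab
      have hfib := hb.toggleX_fib_T hup hcross hqR hqB hW hT huW
      have hs : ∀ j, (toggleX u p F q W).2.1 j = false := fun j => by
        simp [toggleX, if_pos huW, hT j]
      constructor
      · rintro ⟨⟨j, hj⟩, -⟩
        rw [hs j] at hj; exact Bool.noConfusion hj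
      · rintro ⟨-, i, hatt, hi⟩
        simp only [flipXG] at hatt hi
        rw [hfib, attE_attToggle_flip] at hatt
        rw [hfib] at hi
        simp only [attToggle, FibKE.flip, if_pos hatt, Bool.not_not] at hi
        exact hqR ⟨⟨Classical.arbitrary ι, hT _⟩, i, hatt, hi⟩
    · -- B-slab → T-slab
      have hfib := hb.toggleX_fib_B hup hcross hqR hqB hW hB huW
      have hs : ∀ j, (toggleX u p F q W).2.1 j = true := fun j => by
        simp [toggleX, if_pos huW, hB j]
      constructor
      · rintro ⟨-, i, hatt, hi⟩
        rw [hfib, attE_attToggle_flip] at hatt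
        rw [hfib, attToggle_flip_flip] at hi
        have hi' : (if attE G q.2.2.flip i then !q.2.2.2.2 i else q.2.2.2.2 i) = false := hi
        rw [if_pos hatt, Bool.not_eq_false'] at hi'
        apply hqB
        refine ⟨⟨Classical.arbitrary ι, by simp [flipXG, flipAll, hB]⟩, i, hatt, ?_⟩
        show (!q.2.2.2.2 i) = false
        rw [hi']; rfl
      · rintro ⟨⟨j, hj⟩, -⟩
        simp [flipXG, flipAll, hs j] at hj
  · -- `u ∉ W`: only far arms toggle
    have h2 := hb.toggleX_snd_of_notMem hup hcross hqR hqB hW huW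
    constructor
    · intro hl
      apply hqR
      simp only [LeakRX] at hl ⊢
      rw [h2] at hl
      exact hl
    · intro hl
      apply hqB
      simp only [LeakBX, LeakRX, flipXG] at hl ⊢
      rw [h2] at hl
      exact hl

end Orbit

section OrbitThm

variable [Fintype E]

variable {ends : E → Sym2 V} {σ : Config E} {h u : V} {ι X κ : Type*} {U : ι → Set V}
  {p : X → V} {G : SimpleGraph X} {F : κ → Set V} (hb : CrossBase ends σ h u U p G F)
  (hup : ∀ i, ∃ e, ends e = s(u, p i)) (hcross : ∀ i j, G.Adj i j → ∃ e, ends e = s(p i, p j))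
  (hconnU : ∀ j, ∀ x ∈ U j, ∀ y ∈ U j, y ∈ cluster ends (fun e => decide (e ∈ within ends (U j))) x)
  (hconnF : ∀ k, ∀ x ∈ F k, ∀ y ∈ F k, y ∈ cluster ends (fun e => decide (e ∈ within ends (F k))) x)
include hb hup hcross hconnU hconnF

/-- **Every point of the coarse orbit of a core-free point of the block is a point of the
block.** -/
theorem CrossBase.exists_crossReal_of_mem_orbit [Nonempty ι] {q : PtXG ι κ X G}
    (hqR : ¬ LeakRX G q) (hqB : ¬ LeakBX G q)
    (hc : CoreFree ends (crossReal ends u U p G F σ q) h) {ζ'' : Config E}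
    (hζ'' : ζ'' ∈ orbit ends (allRed ends (crossReal ends u U p G F σ q) h) h) :
    ∃ q' : PtXG ι κ X G, (¬ LeakRX G q' ∧ ¬ LeakBX G q') ∧ ζ'' = crossReal ends u U p G F σ q' := by
  obtain ⟨P, hP⟩ := exists_armsUnion_of_mem_orbit hc hζ''
  have hW := BigBlock.armClosed_armsUnion (ends := ends) (ζ := crossReal ends u U p G F σ q) (h := h) P
  refine ⟨toggleX u p F q (armsUnion (arms ends (crossReal ends u U p G F σ q) h) P),
    hb.not_leak_toggleX hup hcross hqR hqB hW (hb.slab_of_coreFree hup hcross hqR hqB hc), ?_⟩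
  rw [hP]
  exact hb.flip_armClosed_eq_crossReal hup hcross hconnU hconnF hqR hqB hW

end OrbitThm

end CrossArm

end Summit.Ventures.PercRepro2
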